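import Mathlib.RingTheory.PowerSeries.Derivative
import Mathlib.RingTheory.PowerSeries.Substitution
import Mathlib.RingTheory.PowerSeries.Log
import Mathlib.RingTheory.PowerSeries.Binomial
import HarnessLib

/-!
# Log-rigidity of the cusp-axis twisting equation `(1+X)^e · F((1+X)^λ − 1) = μ · F` over a field of characteristic `0`

S. Mochizuki, *The étale theta function and its Frobenioid-theoretic manifestations*, Publ. RIMS **45** (2009) [EtTh],
§1 p. 12 («`Δ_X` … a profinite free group on 2 generators», the cusp of the once-punctured curve) and the §2 preamble
p. 35 (PDF; printed p. 261), ll. 55–60 («`x` for the unique cusp of `X^log`», «`D_x ⊆ Π_X` is the decomposition group associated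
to `x`», «the inertia group `I_x ⊆ D_x`» mapping isomorphically onto `Δ_Θ`; Def. 2.1 on p. 36 defines the orbicurve TYPES, not these
groups — re-pointed per referee finding F-A43-2a) [cite: MochizukiEtTh2009, §1 p.12]; the power-series algebra is classical [folklore].
abc-iut cell, layer L2, seat abc-iut-L2-t7 (gen 9): piece **K3 «LOG-RIGIDITY»** of FINDING F-L2t7g9-1
(HOME/staging/L2/L2-t7/g9/FINDING-LoopholeClosed-AffineTwist.md, ADOPTED abc-iut-L2-lead R1245), the algebraic heart of
«no corrected cusp axis is normalised by a non-torsion power twist».  PROOF-ONLY over Mathlib (no definition, no instance,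
no `Prop` fact, no tree dependency).

THE EQUATION.  In the pro-`ℓ` metabelian shadow `ℤ_ℓ⟦X⟧ ⋊ ℤ_ℓ` of the free profinite group `F̂₂ = ⟨a, b⟩^∧` (with `a ↦ (1;0)`,
`b ↦ (0;1)`, `e` acting by `(1+X)^e`) the cusp commutator `c = [a,b]` maps to `−X`, `γ₃(F̂₂)‾` into `X²ℤ_ℓ⟦X⟧`, and the
power twist `θ_λ : a ↦ a, b ↦ b^λ` of the cell's χ-models (abc-iut-w5-d024 `twist`, abc-iut-L2-t1 `actχ`) becomes
`f(X) ↦ f((1+X)^λ − 1)`.  «Some lift `g·θ_λ` normalises the procyclic group generated by a corrected axis `z ∈ c^v·γ₃‾`»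
therefore forces, for `F = X·u(X)` the image of `z`,

    (★)  (1+X)^e · F((1+X)^λ − 1) = μ · F(X).

THIS FILE (field `K` of characteristic `0`; `(1+X)^r := PowerSeries.binomialSeries K r`, `log(1+X) := PowerSeries.log K`):
* §1 the invariant derivation `f ↦ (1+X)·f′`: `(1+X)·log′ = 1`, `(1+X)·((1+X)^r)′ = r·(1+X)^r`
  (`Ring.choose_smul_choose`), the CHAIN RULE along `[λ](X) := (1+X)^λ − 1` (Mathlib `derivative_subst`);
* §2 three uniqueness lemmas: the ODE `(1+X)·H′ = a·H`, `H(0) = 1` has the unique solution `(1+X)^a`; `G ∘ [λ] = G` with `λ`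
  not a root of unity forces `G` constant; equal invariant derivatives and constant terms force equality;
* §3 **`log_rigidity`**: if `λ ≠ 0` is not a root of unity, `F(0) = 0`, `F′(0) ≠ 0` and (★) holds, then `μ = λ` and
  `F = F′(0) · (1+X)^{−e/(λ−1)} · log(1+X)`; the torsion case is genuinely different (memo §1 SHARPNESS);
* §4 **`no_subring_solution`**: if `R ⊆ K` is a subring containing `1/i!` and `1/j` for `i, j < q` but not `1/q`
  (`q ≥ 3`; e.g. `ℤ_(ℓ) ⊂ ℚ` or `ℤ_ℓ ⊂ ℚ_ℓ`, `q = ℓ` an odd prime), then (★) has NO solution with `F(0) = 0`,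
  coefficients in `R` and `F′(0) ∈ R^×` — the `X²`-coefficient `−k − ½` puts `k = e/(λ−1)` in `R`, and then the
  `X^q`-coefficient is `±1/q` modulo `R` (memo §2 (5): the corrected cusp axis is never `ℓ`-integral).
HONEST FRAMING: a theorem about formal power series, used for OUR semi-synthetic carriers only; nothing of [EtTh] is asserted;
no side is taken on [IUTchIII] Cor. 3.12; typed ≠ proved elsewhere, but everything here is proved.
-/

noncomputable section

open PowerSeries

namespace Literature.AnabelianGeometry.EtaleTheta.CuspAxisLogRigidity

variable {K : Type*} [Field K] [CharZero K]

/-! ### §1 Calculus of the invariant derivation `f ↦ (1 + X) · f′` -/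

/-- The coefficients of the binomial series `(1+X)^r` over a field of characteristic zero are the
generalised binomial coefficients `Ring.choose r n`. (classical) [cite: MochizukiEtTh2009, §1 p.12] -/
theorem coeff_binomialSeries (r : K) (n : ℕ) : coeff n (binomialSeries K r) = Ring.choose r n := by
  rw [binomialSeries_coeff, smul_eq_mul, mul_one]

/-- `(1 + X) · log(1+X)′ = 1`: the logarithm is a primitive of the invariant differential. (classical)
[cite: MochizukiEtTh2009, §1 p.12] -/
theorem one_add_X_mul_derivative_log : (1 + X : K⟦X⟧) * d⁄dX K (log K) = 1 := by
  rw [deriv_log]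
  ext n
  rcases n with _ | n
  · simp
  · rw [add_mul, one_mul, map_add, coeff_succ_X_mul, coeff_mk, coeff_mk, coeff_one, if_neg n.succ_ne_zero,
      ← map_add, pow_succ, mul_neg_one, neg_add_cancel, map_zero]

/-- `((1+X)^r)′ = r · (1+X)^{r−1}` for the formal binomial series. (classical) [cite: MochizukiEtTh2009, §1 p.12] -/
theorem derivative_binomialSeries (r : K) :
    d⁄dX K (binomialSeries K r) = r • binomialSeries K (r - 1) := by
  ext n
  rw [coeff_derivative, coeff_binomialSeries, map_smul, coeff_binomialSeries, smul_eq_mul]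
  have h := Ring.choose_smul_choose r (show 1 ≤ n + 1 from Nat.le_add_left 1 n)
  rw [Nat.choose_one_right, Ring.choose_one_right, Nat.add_sub_cancel, nsmul_eq_mul] at h
  push_cast at h
  rw [mul_comm]
  exact h

/-- `(1+X)^1 = 1 + X`. (classical) [cite: MochizukiEtTh2009, §1 p.12] -/
theorem binomialSeries_one : binomialSeries K (1 : K) = 1 + X := by
  rw [show (1 : K) = ((1 : ℕ) : K) by norm_num, binomialSeries_nat, pow_one]

/-- `(1 + X) · ((1+X)^r)′ = r · (1+X)^r`: the binomial series is an eigenvector of the invariant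
derivation. (classical) [cite: MochizukiEtTh2009, §1 p.12] -/
theorem one_add_X_mul_derivative_binomialSeries (r : K) :
    (1 + X : K⟦X⟧) * d⁄dX K (binomialSeries K r) = r • binomialSeries K r := by
  rw [derivative_binomialSeries, mul_smul_comm, ← binomialSeries_one, ← binomialSeries_add, add_sub_cancel]

/-- `(1+X)^r · (1+X)^{−r} = 1`. (classical) [cite: MochizukiEtTh2009, §1 p.12] -/
theorem binomialSeries_mul_neg (r : K) : binomialSeries K r * binomialSeries K (-r) = 1 := by
  rw [← binomialSeries_add, add_neg_cancel, binomialSeries_zero]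

/-- The constant coefficient of the twisting series `[λ](X) := (1+X)^λ − 1` vanishes. (classical)
[cite: MochizukiEtTh2009, §1 p.12] -/
theorem constantCoeff_bracket (l : K) : constantCoeff (binomialSeries K l - 1) = 0 := by
  rw [map_sub, binomialSeries_constantCoeff, map_one, sub_self]

/-- `[λ](X)` is substitutable. (classical) [cite: MochizukiEtTh2009, §1 p.12] -/
theorem hasSubst_bracket (l : K) : HasSubst (binomialSeries K l - 1) :=
  HasSubst.of_constantCoeff_zero' (constantCoeff_bracket l)

/-- `(1 + X) · [λ]′ = λ · (1 + [λ])`. (classical) [cite: MochizukiEtTh2009, §1 p.12] -/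
theorem one_add_X_mul_derivative_bracket (l : K) :
    (1 + X : K⟦X⟧) * d⁄dX K (binomialSeries K l - 1) = l • (1 + (binomialSeries K l - 1)) := by
  rw [map_sub, Derivation.map_one_eq_zero, sub_zero, one_add_X_mul_derivative_binomialSeries, add_sub_cancel]

omit [CharZero K] in
/-- Substituting into a constant-free series keeps the constant coefficient: if `P(0) = 0` then
`(U ∘ P)(0) = U(0)`. (classical) [cite: MochizukiEtTh2009, §1 p.12] -/
theorem constantCoeff_subst_of_constantCoeff_eq_zero {P : K⟦X⟧} (hP : constantCoeff P = 0) (U : K⟦X⟧) :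
    constantCoeff (U.subst P) = constantCoeff U := by
  have hs : HasSubst P := HasSubst.of_constantCoeff_zero' hP
  conv_lhs => rw [eq_X_mul_shift_add_const U]
  rw [← coe_substAlgHom hs, map_add, map_mul, C_eq_algebraMap, AlgHom.commutes, coe_substAlgHom hs, subst_X hs,
    map_add, map_mul, hP, zero_mul, zero_add, ← C_eq_algebraMap, constantCoeff_C]

/-- CHAIN RULE for the invariant derivation along `[λ]`: `(1+X)·(f ∘ [λ])′ = λ · ((1+X)·f′) ∘ [λ]`.
(classical power-series algebra, for the
cusp-axis equation of the cell's χ-models) [cite: MochizukiEtTh2009, §1 p.12] -/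
theorem one_add_X_mul_derivative_subst_bracket (l : K) (f : K⟦X⟧) :
    (1 + X : K⟦X⟧) * d⁄dX K (f.subst (binomialSeries K l - 1)) =
      l • ((1 + X : K⟦X⟧) * d⁄dX K f).subst (binomialSeries K l - 1) := by
  have hs := hasSubst_bracket (K := K) l
  rw [derivative_subst (A := K) hs, mul_left_comm, one_add_X_mul_derivative_bracket, mul_smul_comm, ← coe_substAlgHom hs,
    map_mul, map_add, map_one, coe_substAlgHom hs, subst_X hs, mul_comm]

/-! ### §2 Three uniqueness lemmas -/

/-- ODE UNIQUENESS: a series `H` with `(1+X)·H′ = a·H` is determined by `H(0)`; in particular if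
`H(0) = 1` then `H = (1+X)^a`. (classical) [cite: MochizukiEtTh2009, §1 p.12] -/
theorem eq_binomialSeries_of_derivative {a : K} {H : K⟦X⟧} (hH : (1 + X : K⟦X⟧) * d⁄dX K H = a • H)
    (h0 : constantCoeff H = 1) : H = binomialSeries K a := by
  have hT := one_add_X_mul_derivative_binomialSeries (K := K) a
  -- coefficient recursion: (n+1) h_{n+1} + n h_n = a h_n
  have hrec : ∀ (G : K⟦X⟧), (1 + X : K⟦X⟧) * d⁄dX K G = a • G →
      ∀ n, coeff (n + 1) G = (a - n) / (n + 1) * coeff n G := by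
    intro G hG n
    have h := congrArg (coeff n) hG
    rw [add_mul, one_mul, map_add, coeff_derivative, map_smul, smul_eq_mul] at h
    rcases n with _ | n
    · simp only [Nat.cast_zero, zero_add, mul_one, coeff_zero_X_mul, add_zero] at h
      simp only [Nat.cast_zero, sub_zero, zero_add, div_one]
      exact h
    · rw [coeff_succ_X_mul, coeff_derivative] at h
      have hn : ((n : K) + 1 + 1) ≠ 0 := by norm_cast
      push_cast at h ⊢
      field_simp
      linear_combination h
  ext n
  induction n with
  | zero => rw [coeff_zero_eq_constantCoeff_apply, h0, coeff_zero_eq_constantCoeff_apply, binomialSeries_constantCoeff]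
  | succ n ih => rw [hrec H hH n, hrec _ hT n, ih]

/-- RIGIDITY OF `f ↦ f ∘ [λ]`: if `λ` is not a root of unity and `G ∘ [λ] = G`, then `G` is constant.
(classical power-series algebra, for the
cusp-axis equation of the cell's χ-models) [cite: MochizukiEtTh2009, §1 p.12] -/
theorem eq_C_of_subst_bracket_eq {l : K} (hl : ∀ m : ℕ, 0 < m → l ^ m ≠ 1) {G : K⟦X⟧}
    (hG : G.subst (binomialSeries K l - 1) = G) : G = C (constantCoeff G) := by
  set P : K⟦X⟧ := binomialSeries K l - 1 with hPdef
  have hs : HasSubst P := hasSubst_bracket l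
  have hP0 : constantCoeff P = 0 := constantCoeff_bracket l
  -- H := G - C(G 0) satisfies H ∘ P = H and H(0) = 0
  set H : K⟦X⟧ := G - C (constantCoeff G) with hHdef
  have hH : H.subst P = H := by
    rw [hHdef, subst_sub hs, subst_C, hG]; rfl
  have hH0 : constantCoeff H = 0 := by rw [hHdef, map_sub, constantCoeff_C, sub_self]
  suffices hz : H = 0 by rw [hHdef, sub_eq_zero] at hz; exact hz
  by_contra hne
  -- n := order of H (a natural number ≥ 1)
  obtain ⟨n, hn⟩ : ∃ n : ℕ, H.order = n := ENat.ne_top_iff_exists.mp (order_eq_top.not.mpr hne) |>.imp fun n h => h.symm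
  have hcoeff : coeff n H ≠ 0 := by
    have := coeff_order hne; rwa [hn, ENat.toNat_coe] at this
  have hlt : ∀ i < n, coeff i H = 0 := fun i hi => coeff_of_lt_order i (by rw [hn]; exact_mod_cast hi)
  have hn0 : 0 < n := by
    rcases Nat.eq_zero_or_pos n with rfl | h
    · rw [coeff_zero_eq_constantCoeff_apply] at hcoeff; exact absurd hH0 hcoeff
    · exact h
  -- H = X^n * U with U(0) = coeff n H
  set U : K⟦X⟧ := mk fun p => coeff (p + n) H with hUdef
  have hHU : H = X ^ n * U := by
    ext d
    by_cases hd : d < n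
    · rw [hlt d hd, coeff_X_pow_mul', if_neg (not_le.mpr hd)]
    · obtain ⟨e, rfl⟩ := Nat.exists_eq_add_of_le (not_lt.mp hd)
      rw [add_comm, coeff_X_pow_mul, hUdef, coeff_mk]
  -- P = X * Q with Q(0) = λ
  set Q : K⟦X⟧ := mk fun p => coeff (p + 1) P with hQdef
  have hPQ : P = X * Q := by
    have := eq_X_mul_shift_add_const P; rw [hP0, map_zero, add_zero] at this; exact this
  have hQ0 : constantCoeff Q = l := by
    rw [← coeff_zero_eq_constantCoeff_apply, hQdef, coeff_mk, zero_add, hPdef, map_sub, coeff_binomialSeries,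
      Ring.choose_one_right, coeff_one, if_neg one_ne_zero, sub_zero]
  -- coefficient n of H ∘ P is λ^n · coeff n H
  have hUP : constantCoeff (U.subst P) = coeff n H := by
    rw [constantCoeff_subst_of_constantCoeff_eq_zero hP0, ← coeff_zero_eq_constantCoeff_apply, hUdef, coeff_mk,
      zero_add]
  have key : coeff n (H.subst P) = l ^ n * coeff n H := by
    rw [hHU, ← coe_substAlgHom hs, map_mul, map_pow, coe_substAlgHom hs, subst_X hs, coeff_X_pow_mul' U n n,
      if_pos le_rfl, Nat.sub_self]
    rw [hPQ, mul_pow, mul_assoc, coeff_X_pow_mul', if_pos le_rfl, Nat.sub_self, coeff_zero_eq_constantCoeff_apply,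
      map_mul, map_pow, hQ0, ← hPQ, hUP, hUdef, coeff_mk, zero_add]
  rw [hH] at key
  have : (l ^ n - 1) * coeff n H = 0 := by rw [sub_mul, one_mul, ← key, sub_self]
  rcases mul_eq_zero.mp this with h | h
  · exact hl n hn0 (sub_eq_zero.mp h)
  · exact hcoeff h

/-- PRIMITIVE UNIQUENESS: `(1+X)·F′ = (1+X)·G′` and `F(0) = G(0)` imply `F = G`. (classical)
[cite: MochizukiEtTh2009, §1 p.12] -/
theorem eq_of_one_add_X_mul_derivative_eq {F G : K⟦X⟧}
    (hD : (1 + X : K⟦X⟧) * d⁄dX K F = (1 + X : K⟦X⟧) * d⁄dX K G) (h0 : constantCoeff F = constantCoeff G) :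
    F = G := by
  have hu : IsUnit (1 + X : K⟦X⟧) := by
    rw [isUnit_iff_constantCoeff, map_add, map_one, constantCoeff_X, add_zero]; exact isUnit_one
  exact derivative.ext (hu.mul_right_injective hD) h0

/-! ### §3 The log-rigidity theorem -/

/-- **LOG-RIGIDITY.** Over a field `K` of characteristic `0`, let `λ ∈ K` be non-zero and not a root of
unity, `e, μ ∈ K`, and let `F ∈ K⟦X⟧` with `F(0) = 0`, `F′(0) ≠ 0` satisfy the twisting equation
`(1+X)^e · F((1+X)^λ − 1) = μ · F`.  Then `μ = λ` and `F = F′(0) · (1+X)^{−e/(λ−1)} · log(1+X)`.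
(The normalising condition for a corrected cusp axis in the pro-`ℓ` metabelian shadow of the power-twist
carriers of the abc-iut cell's χ-models; `F` = image of the axis generator.) [cite: MochizukiEtTh2009, §1 p.12] -/
theorem log_rigidity {l e μ : K} (hl0 : l ≠ 0) (hl : ∀ m : ℕ, 0 < m → l ^ m ≠ 1) {F : K⟦X⟧}
    (hF0 : constantCoeff F = 0) (hF1 : coeff 1 F ≠ 0)
    (hEq : binomialSeries K e * F.subst (binomialSeries K l - 1) = μ • F) :
    μ = l ∧ F = coeff 1 F • (binomialSeries K (-(e / (l - 1))) * log K) := by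
  set P : K⟦X⟧ := binomialSeries K l - 1 with hPdef
  have hs : HasSubst P := hasSubst_bracket l
  have hP0 : constantCoeff P = 0 := constantCoeff_bracket l
  have hl1 : l - 1 ≠ 0 := by
    intro h; exact hl 1 one_pos (by rw [pow_one]; exact (sub_eq_zero.mp h))
  set k : K := e / (l - 1) with hkdef
  have hke : l * k - e = k := by rw [hkdef]; field_simp; ring
  -- Step 1: (1+X)^k ∘ [λ] = (1+X)^{λk}
  have hTk : (binomialSeries K k).subst P = binomialSeries K (l * k) := by
    apply eq_binomialSeries_of_derivative
    · rw [one_add_X_mul_derivative_subst_bracket, one_add_X_mul_derivative_binomialSeries, ← coe_substAlgHom hs,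
        map_smul, smul_smul, coe_substAlgHom hs]
    · rw [constantCoeff_subst_of_constantCoeff_eq_zero hP0, binomialSeries_constantCoeff]
  -- Step 2: F₁ := (1+X)^k · F satisfies F₁ ∘ [λ] = μ · F₁
  set F₁ : K⟦X⟧ := binomialSeries K k * F with hF₁def
  have hFP : F.subst P = binomialSeries K (-e) * (μ • F) := by
    have := congrArg (fun G => binomialSeries K (-e) * G) hEq
    rwa [← mul_assoc, mul_comm (binomialSeries K (-e)), binomialSeries_mul_neg, one_mul] at this
  have hF₁ : F₁.subst P = μ • F₁ := by
    rw [hF₁def, ← coe_substAlgHom hs, map_mul, coe_substAlgHom hs, hTk, hFP, ← mul_assoc, ← binomialSeries_add,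
      ← sub_eq_add_neg, hke, mul_smul_comm]
  -- Step 3: G := (1+X)·F₁′ satisfies λ · G ∘ [λ] = μ · G, with G(0) = F′(0) ≠ 0
  set G : K⟦X⟧ := (1 + X : K⟦X⟧) * d⁄dX K F₁ with hGdef
  have hG : l • G.subst P = μ • G := by
    rw [hGdef, ← one_add_X_mul_derivative_subst_bracket, hF₁, Derivation.map_smul, mul_smul_comm]
  have hFX : F = X * mk fun p => coeff (p + 1) F := by
    have h := eq_X_mul_shift_add_const F
    rw [hF0, map_zero, add_zero] at h
    exact h
  have hF₁1 : coeff 1 F₁ = coeff 1 F := by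
    have h1 : coeff 1 (X * (binomialSeries K k * mk fun p => coeff (p + 1) F)) =
        coeff 0 (binomialSeries K k * mk fun p => coeff (p + 1) F) := coeff_succ_X_mul 0 _
    conv_lhs => rw [hF₁def, hFX, mul_left_comm, h1]
    rw [coeff_zero_eq_constantCoeff_apply, map_mul, binomialSeries_constantCoeff, one_mul,
      ← coeff_zero_eq_constantCoeff_apply, coeff_mk, zero_add]
  have hG0 : constantCoeff G = coeff 1 F := by
    rw [hGdef, map_mul, map_add, map_one, constantCoeff_X, add_zero, one_mul, ← coeff_zero_eq_constantCoeff_apply,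
      coeff_derivative, ← hF₁1]
    simp
  have hμ : μ = l := by
    have h := congrArg (coeff 0) hG
    rw [map_smul, map_smul, coeff_zero_eq_constantCoeff_apply, coeff_zero_eq_constantCoeff_apply,
      constantCoeff_subst_of_constantCoeff_eq_zero hP0, hG0, smul_eq_mul, smul_eq_mul] at h
    exact (mul_right_cancel₀ hF1 h).symm
  refine ⟨hμ, ?_⟩
  -- Step 4: G ∘ [λ] = G, hence G is the constant F′(0)
  have hGP : G.subst P = G := by
    rw [hμ] at hG
    have h := congrArg (fun x => l⁻¹ • x) hG
    simpa only [smul_smul, inv_mul_cancel₀ hl0, one_smul] using h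
  have hGC : G = C (coeff 1 F) := by rw [← hG0]; exact eq_C_of_subst_bracket_eq hl hGP
  -- Step 5: F₁ = F′(0) · log(1+X)
  have hF₁log : F₁ = coeff 1 F • log K := by
    apply eq_of_one_add_X_mul_derivative_eq
    · rw [← hGdef, hGC, Derivation.map_smul, mul_smul_comm, one_add_X_mul_derivative_log, smul_eq_C_mul, mul_one]
    · rw [hF₁def, map_mul, hF0, mul_zero, ← coeff_zero_eq_constantCoeff_apply, map_smul,
        coeff_zero_eq_constantCoeff_apply, constantCoeff_log, smul_zero]
  -- Step 6: F = (1+X)^{-k} · F₁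
  calc F = binomialSeries K (-k) * F₁ := by
          rw [hF₁def, ← mul_assoc, mul_comm (binomialSeries K (-k)), binomialSeries_mul_neg, one_mul]
    _ = coeff 1 F • (binomialSeries K (-(e / (l - 1))) * log K) := by rw [hF₁log, mul_smul_comm]

/-! ### §4 Integrality: no solution with coefficients in a subring missing `1/q` -/

omit [CharZero K] in
/-- Values of integer polynomials at elements of a subring stay in the subring (used for the falling
factorials `r(r−1)⋯(r−n+1)`). (classical) [cite: MochizukiEtTh2009, §1 p.12] -/
theorem smeval_int_mem (R : Subring K) (P : Polynomial ℤ) {r : K} (hr : r ∈ R) : P.smeval r ∈ R := by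
  rw [Polynomial.smeval_eq_sum, Polynomial.sum_def]
  refine Subring.sum_mem R fun i _ => ?_
  simp only [Polynomial.smul_pow, zsmul_eq_mul]
  exact R.mul_mem (intCast_mem R _) (R.pow_mem hr i)

/-- The generalised binomial coefficient `Ring.choose r n` lies in a subring `R ∋ r` as soon as
`1/n! ∈ R`. (classical) [cite: MochizukiEtTh2009, §1 p.12] -/
theorem choose_mem (R : Subring K) {r : K} (hr : r ∈ R) {n : ℕ} (hn : ((n.factorial : ℕ) : K)⁻¹ ∈ R) :
    Ring.choose r n ∈ R := by
  have h := Ring.descPochhammer_eq_factorial_smul_choose r n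
  rw [nsmul_eq_mul] at h
  have hfac : ((n.factorial : ℕ) : K) ≠ 0 := by exact_mod_cast n.factorial_ne_zero
  have : Ring.choose r n = ((n.factorial : ℕ) : K)⁻¹ * (descPochhammer ℤ n).smeval r := by
    rw [h, ← mul_assoc, inv_mul_cancel₀ hfac, one_mul]
  rw [this]
  exact R.mul_mem hn (smeval_int_mem R _ hr)

/-- The non-zero coefficients of `log(1+X)` are `±1/j`; they lie in any subring containing `1/j`.
(classical power-series algebra, for the
cusp-axis equation of the cell's χ-models) [cite: MochizukiEtTh2009, §1 p.12] -/
theorem coeff_log_eq (j : ℕ) (hj : j ≠ 0) : coeff j (log K) = (-1) ^ (j + 1) * ((j : K))⁻¹ := by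
  rw [coeff_log, if_neg hj, map_div₀, map_pow, map_neg, map_one, map_natCast, div_eq_mul_inv]

/-- The `X²`-coefficient of `(1+X)^{−k} · log(1+X)` is `−k − ½`. (classical) [cite: MochizukiEtTh2009, §1 p.12] -/
theorem coeff_two_binomialSeries_mul_log (k : K) :
    coeff 2 (binomialSeries K (-k) * log K) = -k - 2⁻¹ := by
  rw [coeff_mul, Finset.Nat.sum_antidiagonal_eq_sum_range_succ_mk, Finset.sum_range_succ, Finset.sum_range_succ,
    Finset.sum_range_succ, Finset.sum_range_zero, zero_add, coeff_binomialSeries, coeff_binomialSeries,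
    coeff_binomialSeries, Ring.choose_zero_right, Ring.choose_one_right, coeff_zero_eq_constantCoeff_apply,
    constantCoeff_log, mul_zero, add_zero, coeff_log_eq 2 two_ne_zero, coeff_log_eq 1 one_ne_zero]
  push_cast
  ring

/-- The `X^q`-coefficient of `(1+X)^{−k} · log(1+X)` is `±1/q` up to an element of any subring `R` containing
`k` and the inverses `1/i!`, `1/j` for `i, j < q`. (classical) [cite: MochizukiEtTh2009, §1 p.12] -/
theorem coeff_binomialSeries_mul_log_sub_mem (R : Subring K) {k : K} (hk : k ∈ R) {q : ℕ} (hq : q ≠ 0)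
    (hfac : ∀ i : ℕ, i < q → ((i.factorial : ℕ) : K)⁻¹ ∈ R) (hinv : ∀ j : ℕ, 0 < j → j < q → ((j : K))⁻¹ ∈ R) :
    coeff q (binomialSeries K (-k) * log K) - (-1) ^ (q + 1) * ((q : K))⁻¹ ∈ R := by
  have hmem : ((0, q) : ℕ × ℕ) ∈ Finset.antidiagonal q := by simp
  rw [coeff_mul, ← Finset.add_sum_erase _ _ hmem, coeff_binomialSeries, Ring.choose_zero_right, one_mul,
    coeff_log_eq q hq, add_sub_cancel_left]
  refine Subring.sum_mem R fun x hx => ?_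
  obtain ⟨hne, hx⟩ := Finset.mem_erase.mp hx
  rw [Finset.mem_antidiagonal] at hx
  have hi0 : x.1 ≠ 0 := by
    rintro h; apply hne; rw [h, zero_add] at hx; exact Prod.ext h hx
  by_cases hj0 : x.2 = 0
  · rw [hj0, coeff_zero_eq_constantCoeff_apply, constantCoeff_log, mul_zero]; exact R.zero_mem
  · rw [coeff_binomialSeries, coeff_log_eq x.2 hj0]
    refine R.mul_mem (choose_mem R (R.neg_mem hk) (hfac x.1 (by omega))) (R.mul_mem ?_ (hinv x.2 (by omega) (by omega)))
    exact R.pow_mem (R.neg_mem R.one_mem) _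

/-- **NO INTEGRAL SOLUTION.** Let `R ⊆ K` be a subring containing `1/i!` and `1/j` for all `i, j < q` but NOT
`1/q` (e.g. `ℤ_(ℓ)` or `ℤ_ℓ ⊂ ℚ_ℓ` with `q = ℓ` an odd prime, `q ≥ 3`).  Then the twisting equation
`(1+X)^e · F((1+X)^λ − 1) = μ · F` (`λ ≠ 0` not a root of unity) has NO solution `F` with `F(0) = 0`, all coefficients
in `R` and `F′(0)` a unit of `R` — whatever `e, μ ∈ K`.  (Memo §2 (5): the corrected cusp axis cannot be `ℓ`-integral;
this is the obstruction closing the BOTH-MODEL loophole on the affine power-twist carriers.)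
[cite: MochizukiEtTh2009, §1 p.12] -/
theorem no_subring_solution (R : Subring K) {q : ℕ} (hq3 : 3 ≤ q)
    (hfac : ∀ i : ℕ, i < q → ((i.factorial : ℕ) : K)⁻¹ ∈ R) (hinv : ∀ j : ℕ, 0 < j → j < q → ((j : K))⁻¹ ∈ R)
    (hq : ((q : K))⁻¹ ∉ R) {l e μ : K} (hl0 : l ≠ 0) (hl : ∀ m : ℕ, 0 < m → l ^ m ≠ 1) {F : K⟦X⟧}
    (hF0 : constantCoeff F = 0) (hF1 : coeff 1 F ≠ 0) (hFR : ∀ n, coeff n F ∈ R) (hF1R : (coeff 1 F)⁻¹ ∈ R) :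
    binomialSeries K e * F.subst (binomialSeries K l - 1) ≠ μ • F := by
  intro hEq
  obtain ⟨-, hF⟩ := log_rigidity hl0 hl hF0 hF1 hEq
  have hcoeff : ∀ n, coeff n (binomialSeries K (-(e / (l - 1))) * log K) ∈ R := by
    intro n
    have h := congrArg (coeff n) hF
    rw [map_smul, smul_eq_mul] at h
    have : coeff n (binomialSeries K (-(e / (l - 1))) * log K) = (coeff 1 F)⁻¹ * coeff n F := by
      rw [h, ← mul_assoc, inv_mul_cancel₀ hF1, one_mul]
    rw [this]
    exact R.mul_mem hF1R (hFR n)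
  -- the X²-coefficient puts the exponent in R
  have hk : e / (l - 1) ∈ R := by
    have h2 := hcoeff 2
    rw [coeff_two_binomialSeries_mul_log] at h2
    have h : e / (l - 1) = -((-(e / (l - 1)) - 2⁻¹) + 2⁻¹) := by ring
    rw [h]
    exact R.neg_mem (R.add_mem h2 (by exact_mod_cast hinv 2 two_pos (by omega)))
  -- the X^q-coefficient then forces 1/q ∈ R
  have hq0 : q ≠ 0 := by omega
  have hdiff := coeff_binomialSeries_mul_log_sub_mem R hk hq0 hfac hinv
  have hunit : (-1 : K) ^ (q + 1) * ((q : K))⁻¹ ∈ R := by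
    have := R.sub_mem (hcoeff q) hdiff
    rwa [sub_sub_cancel] at this
  apply hq
  have h : ((q : K))⁻¹ = (-1) ^ (q + 1) * ((-1) ^ (q + 1) * ((q : K))⁻¹) := by
    rw [← mul_assoc, ← pow_add, ← two_mul, pow_mul, neg_one_sq, one_pow, one_mul]
  rw [h]
  exact R.mul_mem (R.pow_mem (R.neg_mem R.one_mem) _) hunit

end Literature.AnabelianGeometry.EtaleTheta.CuspAxisLogRigidity

end
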